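import Summits.ResolutionOfSingularities.ResolutionOfSingularities.Theorems.FrobeniusClosingSteerEventualStep
import Summits.ResolutionOfSingularities.ResolutionOfSingularities.Theorems.FrobeniusClosingSteerDivergentTail
import Summits.ResolutionOfSingularities.ResolutionOfSingularities.Theorems.FrobeniusClosingSteerMonomialStageTrichotomy
import Summits.ResolutionOfSingularities.ResolutionOfSingularities.Theorems.FrobeniusClosingSteerCore4SteeredRunExists
import Summits.ResolutionOfSingularities.ResolutionOfSingularities.Theorems.FrobeniusClosingSteerCore4RunTrichotomy
import HarnessLib

/-!
# Crux `Steer` (stmt-ResolutionOfSingularities-16345), line `switching_dichotomy` r22: the (α) heart is DIVERGENT —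
# slot-ready composition of E-4 and E-7 from the CORE DATUM binders

OURS (campaign `res-hironaka`, rung L ★L-G4, slot W4.1, chain W4.1; seat `res-L0-w41-stub-4` g3; Theses-free helper for the
holder res-L0-w41-lead-1's line `switching_dichotomy`; replaces the role of no printed item; NOT a statement of the
manuscript under review [claim: Hironaka2017, status: under-review]; AI-produced, which is weaker than expert review).

**E-8 `divergent_of_core_not_isTorsorRun`.** At the point of `concl_of_phasesSSL` where the residuals Φ3ᴸˢ / Φ4ᴸˢ
(resp. strat-1's S0–S3) are invoked — i.e. for a core datum (only `t ^ p ∈ A₀`, regularity at the centre, `ZeroDim`,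
`¬ dim ≤ 2`, «`t ^ p` not a `p`-th power at the centre» are used) that is STRONGLY SWITCHING, WITHOUT proper coarsening,
with NO log-final member (`∀ M, ¬ LogExitAt (R M) p A₀ t`, unfolded) and NO eternal affine torsor run of `t` from any
stage along `j ↦ R (M + j)` (the `het` test negated, specialised to `s' := t`) — the exceptional values of the point
sequence DIVERGE: `∀ c ≠ 0, ∃ n, ∏_{i<n} v (x i) < v c` for every choice of exceptional parameters `x i`
(additively `Σ_i v(𝔪_i) = ∞`).

All the work is in the tree: `t ∉ Frac A₀` (`SteeredRun.not_mem_closure_of_ne_pow`, p499045), the cleaner of `t ^ p`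
into the maximal ideal of `R 0` (perfect residue field of a member, `MonomialStage.perfectField_residueField` +
`exists_isUnit_sub_pow_mem_maximalIdeal`, p505120), `O ≠ ⊤` from `¬ dim ≤ 2` (`exists_mem_centre_of_not_ringKrullDim_le_two`,
p473559), rank one ⇒ archimedean (`arch_of_not_hasProperCoarsening`, p501382), E-4 `exists_isTorsorRun_of_tail` (p503868)
and E-7 `divergent_of_forall_not_isTorsorRun`. Holder's adoption inside `concl_of_phasesSSL` after `het` fails: destructure
`core`, feed `hss R hR0 hRq`, `hnc`, `hlog` (pushed), and `fun M u h0 hp hs => het ⟨M, t, fun j => R (M + j), u, ⟨htR M, …⟩,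
rfl, fun i => hRq (M + i), h0, hp, hs⟩`; the resulting divergence is a FREE extra hypothesis for Φ3ᴸˢ / Φ4ᴸˢ / S3 — by
Granja–Martínez–Rodríguez (`stronglySwitching_of_divergent`, p505426) such data are strongly switching automatically and by
[HeinzerOlberdingToeniskoetter2017, Prop. 6.2 (3)] of rational rank one. [cite: HeinzerOlberdingToeniskoetter2017, Prop. 6.2]
-/

-- `Summit.<S>.<S>.…` duplicates the summit name by design (single-problem summit).
set_option linter.dupNamespace false

open IsLocalRing
open Literature.AlgebraicGeometry.Resolution

namespace Summit.ResolutionOfSingularities.ResolutionOfSingularities.Theorems.SwitchingDichotomy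

namespace EventualMonomial

open Summit.ResolutionOfSingularities.ResolutionOfSingularities.Theorems.SteerRankThinness
  (HasProperCoarsening rankOne_of_not_hasProperCoarsening)

variable {k K : Type} [Field k] [Field K] [Algebra k K]

/-- **E-8 · the (α) heart is divergent.** For a core datum (the five binders used: `t ^ p ∈ A₀`, regularity at the
centre, `ZeroDim`, `¬ dim ≤ 2`, `t ^ p` not a `p`-th power at the centre) that is strongly switching along its point
sequence `R`, has no proper coarsening, NO log-final member and NO eternal affine torsor run of `t` from any stage, the
exceptional values diverge: `∀ c ≠ 0, ∃ n, ∏_{i<n} v (x i) < v c` for any exceptional parameters `x i` of the members.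
[cite: HeinzerOlberdingToeniskoetter2017, Prop. 6.2] [folklore] -/
theorem divergent_of_core_not_isTorsorRun (p : ℕ) (hp : p.Prime) [CharP k p] [PerfectField k]
    (O : ValuationSubring K) (A₀ : Subalgebra k K) (h₀ : A₀.toSubring ≤ O.toSubring) (t : K)
    (htp : t ^ p ∈ A₀)
    (hreg : IsRegularLocalRing (Localization.AtPrime
      (Ideal.comap (Subring.inclusion h₀) (IsLocalRing.maximalIdeal O))))
    (hzd : ∀ x ∈ O, ∃ f : Polynomial k, f ≠ 0 ∧ Polynomial.aeval (R := k) x f ∈ O.nonunits)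
    (hdim2 : ¬ ringKrullDim (Localization.AtPrime
      (Ideal.comap (Subring.inclusion h₀) (IsLocalRing.maximalIdeal O))) ≤ 2)
    (hc : ∀ c : Localization.AtPrime (Ideal.comap (Subring.inclusion h₀) (IsLocalRing.maximalIdeal O)),
      algebraMap A₀.toSubring (Localization.AtPrime (Ideal.comap (Subring.inclusion h₀)
        (IsLocalRing.maximalIdeal O))) ⟨t ^ p, htp⟩ ≠ c ^ p)
    (hnc : ¬ HasProperCoarsening O)
    (R : ℕ → Subring K) (hR0 : R 0 = locAtCentre A₀.toSubring O)
    (hstep : ∀ i, IsQuadraticTransformAlong O (R i) (R (i + 1)))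
    (hSS : ∀ x : K, x ∈ O → (∃ y ∈ A₀, ∃ z ∈ A₀, z ≠ 0 ∧ x = y / z) → ∃ i, x ∈ R i)
    (hlog : ∀ M, ¬ ∃ (_ : IsLocalRing (R M)),
      (∃ f' : R M, (f' : K) = t ^ p ∧
          ∃ h : R M, h ≠ 0 ∧ (∀ δ : Derivation ℤ (R M) (R M), h ∣ δ f') ∧
            ∃ (δ : Derivation ℤ (R M) (R M)) (u : R M), IsUnit u ∧ δ f' = h * u) ∨
        (∃ t₂ : K, ¬ (∃ y ∈ A₀, ∃ z ∈ A₀, z ≠ 0 ∧ t₂ = y / z) ∧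
          ∃ (s : ℕ) (z : Fin s → R M), IsRsopPart z ∧ ∃ (m : Fin s → ℕ), (∃ l, ¬ p ∣ m l) ∧
            ∃ u : R M, IsUnit u ∧ t₂ ^ p = (∏ l, ((z l : R M) : K) ^ m l) * (u : K)))
    (hnet : ∀ (M : ℕ) (u : ℕ → K), u 0 = t → (∀ j, u j ^ p ∈ R (M + j)) →
      (∀ j, ∃ x' g' : K, (x' ∈ R (M + j) ∧ x' ≠ 0 ∧ O.valuation x' < 1 ∧
          ∀ y ∈ R (M + j), O.valuation y < 1 → O.valuation y ≤ O.valuation x') ∧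
        g' ∈ R (M + j) ∧ u j = x' * u (j + 1) + g') → False)
    (x : ℕ → K)
    (hx : ∀ i, x i ∈ R i ∧ x i ≠ 0 ∧ O.valuation (x i) < 1 ∧
      ∀ y ∈ R i, O.valuation y < 1 → O.valuation y ≤ O.valuation (x i)) :
    ∀ c : K, c ≠ 0 → ∃ n, (∏ i ∈ Finset.range n, O.valuation (x i)) < O.valuation c := by
  classical
  haveI : Fact p.Prime := ⟨hp⟩
  haveI : CharP K p := charP_of_injective_algebraMap (algebraMap k K).injective p
  -- `O ≠ ⊤` from a non-zero element of the centre
  obtain ⟨a, -, ha0, hva⟩ := exists_mem_centre_of_not_ringKrullDim_le_two O A₀ h₀ hdim2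
  have hO : O ≠ ⊤ := by
    intro hO'
    have hinv : O.valuation a⁻¹ ≤ 1 :=
      (O.valuation_le_one_iff _).mpr (by rw [hO']; exact ValuationSubring.mem_top _)
    have h1 : O.valuation a * O.valuation a⁻¹ = 1 := by rw [← map_mul, mul_inv_cancel₀ ha0, map_one]
    have hlt : O.valuation a * O.valuation a⁻¹ < 1 * 1 :=
      mul_lt_mul_of_lt_of_le_of_nonneg_of_pos hva hinv zero_le zero_lt_one
    rw [h1, one_mul] at hlt
    exact lt_irrefl _ hlt
  -- members: regular, dominated; `R 0 ⊇ A₀`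
  obtain ⟨hRreg, hRdom, hmono, -⟩ := sequence_facts O A₀ h₀ hreg R hR0 hstep
  have hRO : ∀ i, R i ≤ O.toSubring := fun i => (hRdom i).1
  have hmax : ∀ i (y : R i), y ∈ maximalIdeal (R i) ↔ O.valuation (y : K) < 1 := fun i =>
    (subringDominates_valuationSubring_iff (hRO i)).mp (hRdom i)
  have hA₀R : ∀ y ∈ A₀, y ∈ R 0 := fun y hy => by
    rw [hR0]
    exact le_locAtCentre A₀.toSubring O hy
  have htR : t ^ p ∈ R 0 := hA₀R _ htp
  -- `t ∉ Frac A₀`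
  have htF : ¬ ∃ y ∈ A₀, ∃ z ∈ A₀, z ≠ 0 ∧ t = y / z := fun h =>
    SteeredRun.not_mem_closure_of_ne_pow O A₀ h₀ hp.ne_zero t htp hreg hc
      ((exists_div_iff_mem_closure A₀ t).mp h)
  -- no member is toroidally log-final for any exchanged radicand (the E2 half of `hlog`)
  have hnl : ∀ (N : ℕ) (_ : IsLocalRing (R N)) (t₂ : K), ¬ (∃ y ∈ A₀, ∃ z ∈ A₀, z ≠ 0 ∧ t₂ = y / z) →
      ¬ ∃ (s : ℕ) (z : Fin s → R N), IsRsopPart z ∧ ∃ (m : Fin s → ℕ), (∃ l, ¬ p ∣ m l) ∧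
        ∃ u : R N, IsUnit u ∧ t₂ ^ p = (∏ l, ((z l : R N) : K) ^ m l) * (u : K) :=
    fun N hN t₂ ht₂ htor => hlog N ⟨hN, Or.inr ⟨t₂, ht₂, htor⟩⟩
  -- a cleaner of `t ^ p` into the maximal ideal of `R 0` (perfect residue field)
  have hclean : ∃ g ∈ R 0, O.valuation (t ^ p - g ^ p) < 1 := by
    by_cases hvt : O.valuation (t ^ p) < 1
    · exact ⟨0, Subring.zero_mem _, by rwa [zero_pow hp.ne_zero, sub_zero]⟩
    · have hvt1 : O.valuation (t ^ p) = 1 :=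
        le_antisymm ((O.valuation_le_one_iff _).mpr (hRO 0 htR)) (not_lt.mp hvt)
      have hu : IsUnit (⟨t ^ p, htR⟩ : R 0) := by
        rw [isUnit_subring_iff_inv_mem]
        refine ⟨pow_ne_zero p fun h => ?_, (hRdom 0).2 _ htR ((O.valuation_le_one_iff _).mp
          (by rw [map_inv₀, hvt1, inv_one]))⟩
        exact htF ⟨0, A₀.zero_mem, 1, A₀.one_mem, one_ne_zero, by rw [h, zero_div]⟩
      have hk : ∀ c : k, algebraMap k K c ∈ R 0 := fun c => hA₀R _ (A₀.algebraMap_mem c)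
      haveI : PerfectField (ResidueField (R 0)) := MonomialStage.perfectField_residueField hzd (hRdom 0) hk
      obtain ⟨c, -, hcm⟩ := MonomialStage.exists_isUnit_sub_pow_mem_maximalIdeal (S := R 0) p hu
      refine ⟨(c : K), c.2, ?_⟩
      have := (hmax 0 _).mp hcm
      simpa using this
  -- E-4 then E-7
  have hrun := exists_isTorsorRun_of_tail p hp O A₀ h₀ hreg R hR0 hstep hSS
    (arch_of_not_hasProperCoarsening O hO hnc A₀) hnl 0 t htR htF hclean
  exact divergent_of_forall_not_isTorsorRun p O (rankOne_of_not_hasProperCoarsening O hO hnc) R t 0 hrun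
    hnet x hx

end EventualMonomial

end Summit.ResolutionOfSingularities.ResolutionOfSingularities.Theorems.SwitchingDichotomy
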